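import Mathlib
import Literature.NumberTheory.Irrationality.BrownZudilin2022.CubicalForm
import Summits.KontsevichZagierPeriods.Zeta5Search.CellularCubicalSubstitution
import Summits.KontsevichZagierPeriods.Zeta5Search.WedgeDictionaryDescent22Mirror
import HarnessLib

/-!
# ζ(5) search — the involution `i₁` preserves the cellular integral `I(a)`, unconditionally (cell `pub-zeta5`, seat ct-1 g10)

HONEST FRAMING: systematic search; no irrationality claim unless kernel-certified. Nothing here is an irrationality result, a
worthiness exponent or a denominator statement; class 60;10,12,16,18,22,24,28 words = the coordinator-fixed sentence only.

Brown–Zudilin [BrownZudilin2022, Sect. 3, (9) and (12)]: "the involution `x_j ↦ x_{6−j}` … does not change the form of the integral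
but acts on the set of exponents as (9)", i.e. `I(i₁ a) = I(a)`. In the tree this was known at the level of the cubical form (8)
(`CubicalForm.cubicalIntegral_genI1`, a measure-preserving coordinate reversal) and reached the cellular integral (1) only through the
named fact `cellularIntegral_eq_cubicalIntegral`. With `CellularCubicalSubstitution.cellularIntegral_eq_cubicalIntegral_all` (ct-1 g10,
eq. (8) proved for every `a`) it is now a THEOREM for every `a : Fin 8 → ℤ`:

* `cellularIntegral_genI1 : cellularIntegral (genI1 a) = cellularIntegral a`;
* with `WedgeDictionary.prodF_genI1` (the factorial normalisation `∏_{i∈F} h_i(a)!` of (27) is `i₁`-invariant; gen-1,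
  `WedgeDictionaryDescent22Mirror.lean`, whose `WedgeDictionary.cellularIntegral_genI1` derived `I(i₁ a) = I(a)` for CONVERGENT `a`
  FROM the named fact `invariance_of_converges'`):
* `normalisedIntegral'_genI1 : normalisedIntegral' (genI1 a) = normalisedIntegral' a` — the `i₁`-conjunct of the named fact
  `invariance_of_converges'` ((27) for the generator `i₁`), without any convergence hypothesis (`invariance_of_converges'_genI1`).
The other four generators `p₀₁, p₁₂, h, h'` of `G` (hypergeometric transformations, Sect. 7) are NOT treated.
-/

namespace Summit.KontsevichZagierPeriods.Zeta5Search.CellularIntegralInvolution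

open Literature.NumberTheory.Irrationality.BrownZudilin2022

/-- **`I(i₁ a) = I(a)` for every `a`** ((9): the involution does not change the integral). -/
theorem cellularIntegral_genI1 (a : Fin 8 → ℤ) : cellularIntegral (genI1 a) = cellularIntegral a := by
  rw [CellularCubicalSubstitution.cellularIntegral_eq_cubicalIntegral_all,
    CellularCubicalSubstitution.cellularIntegral_eq_cubicalIntegral_all, cubicalIntegral_genI1]

/-- **(27) for the generator `i₁`, unconditionally:** `I(i₁ a)/∏_{i∈F} h_i(i₁ a)! = I(a)/∏_{i∈F} h_i(a)!` for every `a`. -/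
theorem normalisedIntegral'_genI1 (a : Fin 8 → ℤ) : normalisedIntegral' (genI1 a) = normalisedIntegral' a := by
  rw [normalisedIntegral', normalisedIntegral', cellularIntegral_genI1, WedgeDictionary.prodF_genI1]

/-- The `i₁`-conjunct of the named fact `invariance_of_converges'`, as a theorem (both convergence guards are unnecessary). -/
theorem invariance_of_converges'_genI1 (a : Fin 8 → ℤ) (_ : Converges a) (_ : Converges (genI1 a)) :
    normalisedIntegral' (genI1 a) = normalisedIntegral' a :=
  normalisedIntegral'_genI1 a

/-- Likewise at the level of (10): `J(p₆,…,p₀; q₅,…,q₁)(a) = J(p;q)(a)` transported to `I`: the 12-parameter integral of the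
reversed parameters of `a` is `I(a)`. [BrownZudilin2022, Sect. 3, (12)] -/
theorem Jintegral_genI1 (a : Fin 8 → ℤ) : Jintegral (pOf (genI1 a)) (qOf (genI1 a)) = cellularIntegral a := by
  rw [← CellularCubicalSubstitution.cellularIntegral_eq_Jintegral, cellularIntegral_genI1]

end Summit.KontsevichZagierPeriods.Zeta5Search.CellularIntegralInvolution
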